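import Mathlib
import HarnessLib
import Literature.MathematicalPhysics.QuantumFieldTheory.ConstructiveQFTWave0

/-!
# Change of variables for a bijective flow with exact Jacobian: flow sampling + reweighting is exact

HONEST FRAMING: exact (Metropolis-corrected) sampling algorithms for lattice gauge theory;
figures of merit are autocorrelation/cost numbers at stated couplings and volumes; no
continuum-physics claim.

Venture `LatticeQCDFlow` (cell pub-lqcd), topic `Exactness`, FANOUT row 30 (lean-1), statement
E3 of HOME/VENTURE-STATEMENT.md ("change of variables for a bijective flow with exact
log-Jacobian, over `MeasureTheory.Measure.map`").  NEW WORK of the cell (general measure theory,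
elementary), not a published result: nothing here is cited as a fact.  Printed counterparts,
named only: Lüscher 2010 §2.3–§2.4 eqs. (2.7)–(2.13) (field transformations in HMC);
Albergo–Kanwar–Shanahan 2019 §II (normalizing flows: model density = prior density / Jacobian,
reweighting or Metropolis with `w = p/q`); Nicoli et al. 2020–2021 (flow-based free-energy
estimators).

## Content (reference measure `vol` on a measurable space `Ω`; densities `Ω → ℝ≥0∞`)

* `HasJacobian vol F J` — the flow `F` has (exact) Jacobian `J` w.r.t. `vol`:
  `F_* (J · vol) = vol`.  For a diffeomorphism of a manifold with volume form, `J = |det DF|`;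
  `hasJacobian_of_hasFDerivAt` derives it on a finite-dimensional real space from Mathlib's
  change-of-variables theorem (`map_withDensity_abs_det_fderiv_eq_addHaar`) — the scalar-field
  setting of Albergo–Kanwar–Shanahan 2019; for `Ω = G^E` with product Haar measure (lattice gauge
  fields) it is the HYPOTHESIS a gauge-equivariant coupling layer must certify.
* `map_withDensity_comp_eq` — `F_* ((g ∘ F) · μ) = g · F_* μ` (push-forward of a pulled-back
  density), the one measure-theoretic identity everything rests on.
* `HasJacobian.map_withDensity` — the MODEL DENSITY theorem: a prior of density `(q ∘ F) · J`
  is pushed by `F` to the law of density `q`; `HasJacobian.map_withDensity_equiv` — for a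
  measurable bijection, prior density `r` ↦ model density `q = (r / J) ∘ F⁻¹`
  ("`log q(x) = log r(z) − log |det ∂F(z)|`").
* `withDensity_reweight` — importance reweighting with `w = p / q` turns the law of density `q`
  into the law of density `p` (`q` pointwise nonzero and finite);
* `flow_reweighting_exact` (E3) — sample `z ∼ r · vol`, push through `F`, reweight with
  `p(x)/q(x)` where `q(F z) = r(z)/J(z)` is computable along the flow: the resulting measure is
  EXACTLY `p · vol`, for every flow with exact Jacobian, however badly trained.  The same weights
  are the `w = p/q` of the independence-Metropolis chain of `FlowMCMC.lean` (finite spaces) —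
  the flow only affects the variance / acceptance, never the target.
* `HasJacobian.comp` — layers compose and Jacobians multiply along the flow
  (`J_{G ∘ F} = (J_G ∘ F) · J_F`: log-dets add), `hasJacobian_id`.
* `wilson_flow_reweighting_exact` — the specialisation to lattice gauge theory: `Ω = G^E`
  (`GaugeConfig d L G`), `vol = ⊗_e Haar`, target = the tree's un-normalised Wilson weight
  `wilsonWeight ρ β = e^{−β S_W} · ⊗ Haar`.

Not here: the construction of `J` for concrete gauge-equivariant layers on `SU(N)^E` (needs Haar
measure on the Lie group as a volume form — not in Mathlib), stochastic layers (see
`JarzynskiFinite.lean`), and anything about efficiency.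
-/

namespace Summit.Ventures.LatticeQCDFlow.Exactness

open MeasureTheory
open scoped ENNReal

variable {Ω : Type*} [MeasurableSpace Ω]

/-! ## Push-forward of a pulled-back density -/

/-- `F_* ((g ∘ F) · μ) = g · (F_* μ)`: pushing forward a measure reweighted by a density pulled
back along `F` is the same as reweighting the push-forward. -/
theorem map_withDensity_comp_eq {μ : Measure Ω} {F : Ω → Ω} (hF : Measurable F)
    {g : Ω → ℝ≥0∞} (hg : Measurable g) :
    Measure.map F (μ.withDensity fun z => g (F z)) = (Measure.map F μ).withDensity g := by
  ext s hs
  rw [Measure.map_apply hF hs, withDensity_apply _ (hF hs), withDensity_apply _ hs,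
    Measure.restrict_map hF hs, lintegral_map hg hF]

/-! ## Flows with exact Jacobian -/

/-- The measurable map `F : Ω → Ω` has JACOBIAN `J` with respect to the reference measure `vol`:
`F_* (J · vol) = vol`.  For an orientation-preserving diffeomorphism of a manifold with volume
form `vol` this holds with `J = |det DF|` (change of variables); a normalizing-flow architecture
is designed so that `J` is computable exactly along with `F` ("tractable log-det").  A standard
notion (the Jacobian of measure-theoretic change of variables), recorded as a structure so that
sampler-exactness lemmas can consume it. -/
@[folklore]
structure HasJacobian (vol : Measure Ω) (F : Ω → Ω) (J : Ω → ℝ≥0∞) : Prop where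
  /-- the flow is measurable -/
  measurable : Measurable F
  /-- the Jacobian density is measurable -/
  measurable_jac : Measurable J
  /-- the defining identity `F_* (J · vol) = vol` -/
  map_eq : Measure.map F (vol.withDensity J) = vol

namespace HasJacobian

variable {vol : Measure Ω} {F : Ω → Ω} {J : Ω → ℝ≥0∞}

/-- **Model density of a flow.**  If the PRIOR has density `(q ∘ F) · J` with respect to `vol`,
the push-forward under the flow has density `q`: `F_* ((q ∘ F) · J · vol) = q · vol`.  Read
backwards: the flow's output density `q` is determined by `q(F z) · J(z) = r(z)`, i.e.
`log q(x) = log r(z) − log J(z)` at `x = F z` — the formula every flow sampler evaluates. -/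
theorem map_withDensity (h : HasJacobian vol F J) {q : Ω → ℝ≥0∞} (hq : Measurable q) :
    Measure.map F (vol.withDensity fun z => q (F z) * J z) = vol.withDensity q := by
  have hqF : Measurable fun z => q (F z) := hq.comp h.measurable
  have hmul : (vol.withDensity fun z => q (F z) * J z) =
      (vol.withDensity J).withDensity fun z => q (F z) := by
    rw [← withDensity_mul _ h.measurable_jac hqF]
    congr 1
    funext z
    simp only [Pi.mul_apply]
    exact mul_comm _ _
  rw [hmul, map_withDensity_comp_eq h.measurable hq, h.map_eq]

/-- The same for a measurable BIJECTION `F` and an arbitrary prior density `r`: the model density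
is `q = (r / J) ∘ F⁻¹` (Jacobian pointwise nonzero and finite). -/
theorem map_withDensity_equiv {F : Ω ≃ᵐ Ω} (h : HasJacobian vol F J) (hJ0 : ∀ z, J z ≠ 0)
    (hJtop : ∀ z, J z ≠ ∞) {r : Ω → ℝ≥0∞} (hr : Measurable r) :
    Measure.map F (vol.withDensity r) =
      vol.withDensity fun x => r (F.symm x) / J (F.symm x) := by
  have hq : Measurable fun x => r (F.symm x) / J (F.symm x) :=
    (hr.comp F.symm.measurable).div (h.measurable_jac.comp F.symm.measurable)
  rw [← h.map_withDensity hq]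
  congr 1
  refine withDensity_congr_ae (Filter.Eventually.of_forall fun z => ?_)
  simp only [MeasurableEquiv.symm_apply_apply]
  exact (ENNReal.div_mul_cancel (hJ0 z) (hJtop z)).symm

/-- **Layers compose, Jacobians multiply.**  If `F` has Jacobian `J_F` and `G` has Jacobian
`J_G`, then `G ∘ F` has Jacobian `(J_G ∘ F) · J_F` (log-dets add along the flow). -/
theorem comp {G : Ω → Ω} {K : Ω → ℝ≥0∞} (hG : HasJacobian vol G K) (hF : HasJacobian vol F J) :
    HasJacobian vol (G ∘ F) fun z => K (F z) * J z where
  measurable := hG.measurable.comp hF.measurable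
  measurable_jac := (hG.measurable_jac.comp hF.measurable).mul hF.measurable_jac
  map_eq := by
    rw [← Measure.map_map hG.measurable hF.measurable, hF.map_withDensity hG.measurable_jac,
      hG.map_eq]

end HasJacobian

/-- The identity map has Jacobian `1`. -/
theorem hasJacobian_id (vol : Measure Ω) : HasJacobian vol id fun _ => 1 where
  measurable := measurable_id
  measurable_jac := measurable_const
  map_eq := by
    rw [Measure.map_id]
    exact withDensity_one

/-- **Euclidean flows (the scalar-field case).**  On a finite-dimensional real normed space with
an additive Haar (Lebesgue) measure, an everywhere-differentiable bijection `f` with derivative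
`f'` has Jacobian `|det f'(x)|` — Mathlib's change-of-variables theorem
`map_withDensity_abs_det_fderiv_eq_addHaar` on `s = univ`.  This is the setting of the first
flow-based lattice sampler (real scalar `φ⁴` on `ℝ^V`, Albergo–Kanwar–Shanahan 2019). -/
theorem hasJacobian_of_hasFDerivAt {E : Type*} [NormedAddCommGroup E] [NormedSpace ℝ E]
    [FiniteDimensional ℝ E] [MeasurableSpace E] [BorelSpace E] (μ : Measure E)
    [μ.IsAddHaarMeasure] {f : E → E} {f' : E → E →L[ℝ] E}
    (hf' : ∀ x, HasFDerivAt f (f' x) x) (hinj : Function.Injective f)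
    (hsurj : Function.Surjective f) (hmeas : Measurable fun x => ENNReal.ofReal |(f' x).det|) :
    HasJacobian μ f fun x => ENNReal.ofReal |(f' x).det| where
  measurable :=
    (continuous_iff_continuousAt.mpr fun x => (hf' x).continuousAt).measurable
  measurable_jac := hmeas
  map_eq := by
    have h := map_withDensity_abs_det_fderiv_eq_addHaar (μ := μ) (s := Set.univ)
      MeasurableSet.univ.nullMeasurableSet (fun x _ => (hf' x).hasFDerivWithinAt) hinj.injOn
    rwa [Measure.restrict_univ, Set.image_univ_of_surjective hsurj, Measure.restrict_univ] at h

/-! ## Reweighting and the exactness of flow sampling -/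

/-- **Importance reweighting.**  Reweighting the law of density `q` by `w = p / q` gives the law
of density `p` (for `q` pointwise nonzero and finite): `(p/q) · (q · vol) = p · vol`. -/
theorem withDensity_reweight (vol : Measure Ω) {p q : Ω → ℝ≥0∞} (hp : Measurable p)
    (hq : Measurable q) (hq0 : ∀ x, q x ≠ 0) (hqtop : ∀ x, q x ≠ ∞) :
    (vol.withDensity q).withDensity (fun x => p x / q x) = vol.withDensity p := by
  have hpq : Measurable fun x => p x / q x := hp.div hq
  rw [← withDensity_mul _ hq hpq]
  congr 1
  funext x
  simp only [Pi.mul_apply]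
  exact ENNReal.mul_div_cancel (hq0 x) (hqtop x)

/-- **E3 — flow sampling with exact Jacobian + reweighting is exact.**  Let the flow `F` have
Jacobian `J` w.r.t. `vol`, let the prior have density `r = (q ∘ F) · J` (so that `q` is the
model density, computable along the flow as `q(F z) = r(z)/J(z)`), and let `p` be ANY target
density.  Then pushing prior samples through `F` and reweighting with `w = p/q` yields EXACTLY
the target: `(p/q) · F_*(r · vol) = p · vol`.  No property of `F` beyond the exact Jacobian is
used — a badly trained flow changes the weights' variance (ESS, acceptance), never the target. -/
theorem flow_reweighting_exact {vol : Measure Ω} {F : Ω → Ω} {J : Ω → ℝ≥0∞}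
    (h : HasJacobian vol F J) {p q : Ω → ℝ≥0∞} (hp : Measurable p) (hq : Measurable q)
    (hq0 : ∀ x, q x ≠ 0) (hqtop : ∀ x, q x ≠ ∞) :
    (Measure.map F (vol.withDensity fun z => q (F z) * J z)).withDensity (fun x => p x / q x) =
      vol.withDensity p := by
  rw [h.map_withDensity hq, withDensity_reweight vol hp hq hq0 hqtop]

/-- The same with target EXPECTATIONS: for every measurable `f ≥ 0`,
`∫ f · (p/q) d(F_* (r · vol)) = ∫ f · p d vol` — the reweighted flow estimator is unbiased for
un-normalised target integrals (ratios of two such give normalised expectations). -/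
theorem flow_reweighting_lintegral {vol : Measure Ω} {F : Ω → Ω} {J : Ω → ℝ≥0∞}
    (h : HasJacobian vol F J) {p q : Ω → ℝ≥0∞} (hp : Measurable p) (hq : Measurable q)
    (hq0 : ∀ x, q x ≠ 0) (hqtop : ∀ x, q x ≠ ∞) {f : Ω → ℝ≥0∞} (hf : Measurable f) :
    ∫⁻ x, p x / q x * f x ∂(Measure.map F (vol.withDensity fun z => q (F z) * J z)) =
      ∫⁻ x, p x * f x ∂vol := by
  have hpq : Measurable fun x => p x / q x := hp.div hq
  have h1 := lintegral_withDensity_eq_lintegral_mul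
    (Measure.map F (vol.withDensity fun z => q (F z) * J z)) hpq hf
  have h2 := lintegral_withDensity_eq_lintegral_mul vol hp hf
  simp only [Pi.mul_apply] at h1 h2
  rw [← h1, ← h2, flow_reweighting_exact h hp hq hq0 hqtop]

/-! ## Lattice gauge theory: the Wilson weight as target -/

section Wilson

open Literature.MathematicalPhysics.QuantumFieldTheory

variable {d L N : ℕ} [NeZero L] {G : Type*} [Group G] [TopologicalSpace G] [IsTopologicalGroup G]
  [CompactSpace G] [MeasurableSpace G] [BorelSpace G] (ρ : G →* Matrix (Fin N) (Fin N) ℂ)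

/-- **E3 for lattice gauge fields.**  On `Ω = G^E` (`GaugeConfig d L G`, `G` compact) with the
product Haar reference measure `⊗_e dU_e`, a flow `F` with exact Jacobian `J`, prior density
`(q ∘ F) · J` and reweighting by `e^{−β S_W}/q` produce EXACTLY the tree's un-normalised Wilson
weight `wilsonWeight ρ β = e^{−β S_W(U)} ⊗_e dU_e` (whose normalisation is `wilsonMeasure ρ β`),
provided the Wilson action is measurable (it is continuous for a continuous representation `ρ`).
The gauge-equivariant layers of Kanwar et al. 2020 / Boyda et al. 2021 are instances of `F`;
certifying `HasJacobian` for them needs the Haar volume form on the Lie group (not in Mathlib). -/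
theorem wilson_flow_reweighting_exact (β : ℝ) {F : GaugeConfig d L G → GaugeConfig d L G}
    {J q : GaugeConfig d L G → ℝ≥0∞}
    (h : HasJacobian (Measure.pi fun _ : Edge d L => haarProbability G) F J)
    (hS : Measurable (wilsonAction (d := d) (L := L) ρ)) (hq : Measurable q)
    (hq0 : ∀ U, q U ≠ 0) (hqtop : ∀ U, q U ≠ ∞) :
    (Measure.map F ((Measure.pi fun _ : Edge d L => haarProbability G).withDensity
        fun V => q (F V) * J V)).withDensity
        (fun U => ENNReal.ofReal (Real.exp (-β * wilsonAction ρ U)) / q U) =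
      wilsonWeight ρ β :=
  flow_reweighting_exact h
    (ENNReal.measurable_ofReal.comp (Real.measurable_exp.comp (hS.const_mul (-β)))) hq hq0 hqtop

end Wilson

end Summit.Ventures.LatticeQCDFlow.Exactness
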